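import Mathlib.NumberTheory.FLT.MasonStothers
import Mathlib.Algebra.CharP.Lemmas
import HarnessLib

/-!
# Mason (1984) / Stothers (1981): the projective form of the Mason–Stothers inequality

Reproduction (solo seat `solo-ABC-blind`, 2026-08-19) of a PUBLISHED result:
R. C. Mason, *Diophantine Equations over Function Fields*, LMS Lecture Notes 96, Cambridge 1984,
Ch. 1, Lemma 2 (the "fundamental inequality" for `k(t)`, genus `0`); W. W. Stothers, *Polynomial
identities and Hauptmoduln*, Quart. J. Math. Oxford 32 (1981) 349–370, Thm 1.1.  What is reproduced:
for a three-term identity `a + b + c = 0` of coprime non-zero polynomials over a field of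
characteristic `0`, with `n = max (deg a, deg b, deg c) ≥ 1`,

  `n + 2 ≤ deg rad(abc) + [deg(abc) < 3n]`          (`mason_projective`),

i.e. the fibre of the degree-`n` map `-a/c : ℙ¹ → ℙ¹` over `{0, 1, ∞}` has at least `n + 2` points
(the bracket is `1` exactly when `∞` lies in that fibre).  Mathlib's `Polynomial.abc` is the affine
count `deg x + 1 ≤ deg rad(abc)` for `x ∈ {a, b, c}`, which gives the projective bound only when a
degree drops; the complementary no-drop case (`mason_noDrop`) is proved here from the observation
that for `deg a = deg b = n ≥ 1` the leading terms of `a·b′` and `a′·b` cancel, so the Wronskian has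
degree `≤ 2n − 2` (`natDegree_wronskian_le_of_natDegree_eq`) and Mathlib's divisibility
`divRadical(abc) ∣ W(a,b)` finishes.  Equality `n + 2 = deg rad(abc) + [drop]` characterises Belyi
maps (Riemann–Hurwitz); that converse is NOT formalised here.

Design: statements over `[Field k] [CharZero k]`; no new definitions.  Used on the abc wall of
the solo seat as the count behind "no covering identity gains exponent; lossless iff Belyi-extremal".
-/

noncomputable section

open Polynomial UniqueFactorizationMonoid UniqueFactorizationDomain EuclideanDomain

namespace Literature.NumberTheory.DiophantineGeometry.Mason1984

variable {k : Type*} [Field k] [CharZero k] [DecidableEq k]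

/-- Leading-term cancellation: if `deg a = deg b = n ≥ 1` (characteristic `0`) then
`deg W(a,b) ≤ 2n − 2`. [folklore] -/
theorem natDegree_wronskian_le_of_natDegree_eq {a b : k[X]} {n : ℕ} (hn : 1 ≤ n)
    (ha : a.natDegree = n) (hb : b.natDegree = n) :
    (wronskian a b).natDegree ≤ 2 * n - 2 := by
  have ha0 : a ≠ 0 := by rintro rfl; simp at ha; omega
  have hb0 : b ≠ 0 := by rintro rfl; simp at hb; omega
  have hda0 : derivative a ≠ 0 := derivative_ne_zero.mpr (by omega)
  have hdb0 : derivative b ≠ 0 := derivative_ne_zero.mpr (by omega)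
  have hda : (derivative a).natDegree = n - 1 := by rw [natDegree_derivative, ha]
  have hdb : (derivative b).natDegree = n - 1 := by rw [natDegree_derivative, hb]
  have hdeg1 : (a * derivative b).degree = ((2 * n - 1 : ℕ) : WithBot ℕ) := by
    rw [degree_mul, degree_eq_natDegree ha0, degree_eq_natDegree hdb0, ha, hdb]
    norm_cast; omega
  have hdeg2 : (derivative a * b).degree = ((2 * n - 1 : ℕ) : WithBot ℕ) := by
    rw [degree_mul, degree_eq_natDegree hda0, degree_eq_natDegree hb0, hda, hb]
    norm_cast; omega
  have hlc : (a * derivative b).leadingCoeff = (derivative a * b).leadingCoeff := by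
    rw [leadingCoeff_mul, leadingCoeff_mul, leadingCoeff_derivative, leadingCoeff_derivative,
      ha, hb]
    ring
  by_cases hw : wronskian a b = 0
  · rw [hw]; simp
  have hne : a * derivative b ≠ 0 := mul_ne_zero ha0 hdb0
  have hlt := degree_sub_lt (hdeg1.trans hdeg2.symm) hne hlc
  rw [hdeg1] at hlt
  have hw' : (a * derivative b - derivative a * b) ≠ 0 := hw
  have := (natDegree_lt_iff_degree_lt hw').mpr hlt
  change (a * derivative b - derivative a * b).natDegree ≤ 2 * n - 2
  omega

/-- **Mason–Stothers, no-drop case**: if `a + b + c = 0` with `a, b` coprime and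
`deg a = deg b = deg c = n ≥ 1` in characteristic `0`, then `rad(abc)` has degree `≥ n + 2`.
[cite: Mason1984, Ch. 1 Lemma 2] -/
theorem mason_noDrop {a b c : k[X]} {n : ℕ} (hn : 1 ≤ n) (ha : a.natDegree = n)
    (hb : b.natDegree = n) (hc : c.natDegree = n) (hab : IsCoprime a b) (hsum : a + b + c = 0) :
    n + 2 ≤ (radical (a * b * c)).natDegree := by
  have ha0 : a ≠ 0 := by rintro rfl; simp at ha; omega
  have hb0 : b ≠ 0 := by rintro rfl; simp at hb; omega
  have hc0 : c ≠ 0 := by rintro rfl; simp at hc; omega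
  set w := wronskian a b with wab
  have hbc : IsCoprime b c := by
    rw [add_eq_zero_iff_neg_eq] at hsum
    rw [← hsum, IsCoprime.neg_right_iff]
    convert! IsCoprime.add_mul_left_right hab.symm 1
    rw [mul_one]
  have hsum' : b + c + a = 0 := by rwa [add_rotate] at hsum
  have hca : IsCoprime c a := by
    rw [add_eq_zero_iff_neg_eq] at hsum'
    rw [← hsum', IsCoprime.neg_right_iff]
    convert! IsCoprime.add_mul_left_right hbc.symm 1
    rw [mul_one]
  have wbc : w = wronskian b c := wronskian_eq_of_sum_zero hsum
  have abc_dr_dvd_w : divRadical (a * b * c) ∣ w := by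
    have adr_dvd_w := divRadical_dvd_wronskian_left a b
    have bdr_dvd_w := divRadical_dvd_wronskian_right a b
    have cdr_dvd_w := divRadical_dvd_wronskian_right b c
    rw [← wab] at adr_dvd_w bdr_dvd_w
    rw [← wbc] at cdr_dvd_w
    rw [divRadical_mul (hca.symm.mul_left hbc), divRadical_mul hab]
    exact (hca.divRadical.symm.mul_left hbc.divRadical).mul_dvd
      (hab.divRadical.mul_dvd adr_dvd_w bdr_dvd_w) cdr_dvd_w
  have hw : w ≠ 0 := by
    intro hw0
    have hda : derivative a = 0 := (hab.wronskian_eq_zero_iff.mp (wab ▸ hw0)).1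
    have : a.natDegree = 0 := derivative_eq_zero.mp hda
    omega
  have abc_nz : a * b * c ≠ 0 := mul_ne_zero (mul_ne_zero ha0 hb0) hc0
  have h1 : (divRadical (a * b * c)).natDegree ≤ w.natDegree :=
    Polynomial.natDegree_le_of_dvd abc_dr_dvd_w hw
  have h2 : w.natDegree ≤ 2 * n - 2 := natDegree_wronskian_le_of_natDegree_eq hn ha hb
  have h3 : (a * b * c).natDegree = 3 * n := by
    rw [Polynomial.natDegree_mul (mul_ne_zero ha0 hb0) hc0, Polynomial.natDegree_mul ha0 hb0,
      ha, hb, hc]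
    ring
  have h4 : (a * b * c).natDegree =
      (divRadical (a * b * c)).natDegree + (radical (a * b * c)).natDegree := by
    conv_lhs => rw [← radical_mul_divRadical (a := a * b * c)]
    rw [Polynomial.natDegree_mul radical_ne_zero (divRadical_ne_zero abc_nz), add_comm]
  omega

/-- **Projective Mason–Stothers.**  For `a + b + c = 0` with `a, b` coprime, non-zero, over a field
of characteristic `0`, and `n = max (deg a, deg b, deg c) ≥ 1`:
`n + 2 ≤ deg rad(abc) + [deg(abc) < 3n]` — the fibre of `-a/c : ℙ¹ → ℙ¹` over `{0, 1, ∞}` has at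
least `n + 2` points. [cite: Mason1984, Ch. 1 Lemma 2] -/
theorem mason_projective {a b c : k[X]} (ha0 : a ≠ 0) (hb0 : b ≠ 0) (hc0 : c ≠ 0)
    (hab : IsCoprime a b) (hsum : a + b + c = 0)
    (hn : 1 ≤ max (max a.natDegree b.natDegree) c.natDegree) :
    max (max a.natDegree b.natDegree) c.natDegree + 2 ≤
      (radical (a * b * c)).natDegree +
        (if (a * b * c).natDegree < 3 * max (max a.natDegree b.natDegree) c.natDegree
          then 1 else 0) := by
  have habc : (a * b * c).natDegree = a.natDegree + b.natDegree + c.natDegree := by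
    rw [Polynomial.natDegree_mul (mul_ne_zero ha0 hb0) hc0, Polynomial.natDegree_mul ha0 hb0]
  have hma : a.natDegree ≤ max (max a.natDegree b.natDegree) c.natDegree :=
    (le_max_left _ _).trans (le_max_left _ _)
  have hmb : b.natDegree ≤ max (max a.natDegree b.natDegree) c.natDegree :=
    (le_max_right _ _).trans (le_max_left _ _)
  have hmc : c.natDegree ≤ max (max a.natDegree b.natDegree) c.natDegree := le_max_right _ _
  by_cases hdrop : (a * b * c).natDegree < 3 * max (max a.natDegree b.natDegree) c.natDegree
  · rw [if_pos hdrop]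
    rcases Polynomial.abc ha0 hb0 hc0 hab hsum with ⟨h1, h2, h3⟩ | ⟨da, db, dc⟩
    · have hm : max (max a.natDegree b.natDegree) c.natDegree + 1 ≤
          (radical (a * b * c)).natDegree := by
        rw [← max_add_add_right, ← max_add_add_right]
        exact max_le (max_le h1 h2) h3
      omega
    · -- all derivatives vanish: in characteristic 0 the three polynomials are constant, `n = 0`
      exfalso
      have hda : a.natDegree = 0 := derivative_eq_zero.mp da
      have hdb : b.natDegree = 0 := derivative_eq_zero.mp db
      have hdc : c.natDegree = 0 := derivative_eq_zero.mp dc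
      rw [hda, hdb, hdc] at hn
      simp at hn
  · rw [if_neg hdrop, add_zero]
    push Not at hdrop
    have ha : a.natDegree = max (max a.natDegree b.natDegree) c.natDegree := by omega
    have hb : b.natDegree = max (max a.natDegree b.natDegree) c.natDegree := by omega
    have hc : c.natDegree = max (max a.natDegree b.natDegree) c.natDegree := by omega
    exact mason_noDrop hn ha hb hc hab hsum

end Literature.NumberTheory.DiophantineGeometry.Mason1984

end
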